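import Summits.QuantumFields.YangMills.Theorems.BalabanUVNodesN15KingModelFullPropagatorRiemannWeighted
import Summits.QuantumFields.YangMills.Theorems.BalabanUVNodesN15KingModelFullPropagatorGrad

/-!
# N15 (NE2⁺), King-model rung, part 18a: the WEIGHTED Riemann mass of the GRADIENT of King's fluctuation propagator

Cell `pub-ymgap-dag-n15-d` (R134 acceleration DAG, node N15 = NE2, strategy s3 KING-MODEL RUNG), part 18a — the first brick of the
DERIVATIVE edition of the dressed programme (parts 10–17): King's Prop. 3.8 (3.71) SECOND line and Theorem 3.3's derivative clause for the
DRESSED minimiser `ℋ_w = ℋ − N^{−(d+1)}G·diag(w)·ℋ_w` need, through `∂ℋ_w = ∂ℋ − N^{−(d+1)}(∂G)·diag(w)·ℋ_w`, the row-uniform Riemann letters of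
the GRADIENT `∂^η_μG^η_K(x, y) = N·[G^η_K(x + e_μ, y) − G^η_K(x, y)]` of the full `A = 0` fluctuation propagator.  This file proves the weighted mass:

* ★★ `fullPropD_riemannMassW_unif` — for odd `L ≥ 3`, `a > 0`, mass cap `m₀²`: `∃ δ₁ C > 0 ∀ K ≥ 1 ∀ 0 ≤ δ′ ≤ δ₁ ∀ (cube 2L^e) ∀ 0 < m² ≤ m₀² ∀ μ x`,
  `N^{−(d+1)}·Σ_y |∂^η_μG^η_K(x, y)|·e^{δ′|B(x) − B(y)|_M} ≤ C` — part 11a's induction on n15-e's DIFFERENTIATED peel (part O-a′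
  `fullPropD_peel_abs_le`: the gradient costs ONE power of `L` more, `L^{d+1}∕L²·L`, so the net factor per level is `L^{−1}` instead of `L^{−2}` —
  a gradient of a propagator has mass dimension `−1` — still a contraction for `L ≥ 3` once `e^{δ₁} ≤ 2`), part M′ `ksDSlice_decay_unif` for the
  differentiated slices and [Ba 4] (1.10) clause 2 (`constrainedProp_deriv_decay_blocks_unif`) at the bottom; NO off-diagonal restriction.

HONEST SCOPE.  King's A = 0 scalar model on King-admissible tori `Π ℤ∕(2L^{e+1})`, odd `L ≥ 3`; a Riemann-sum (row-averaged) statement, not a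
pointwise kernel bound (n15-e's parts O-a′∕O-b′ give the pointwise OFF-diagonal decay and rate); count-neutral (`--supports`), not a discharge
of N15, nothing in `YMDAG.*` touched.  WHAT IT IS FOR: the derivative clause of the dressed minimiser's decay and Prop. 3.8 line 2 dressed
(successor parts 18b–18d: weighted gradient RATE, `∂ℋ_w` decay, `∂ℋ_w` step).

References: C. King, Commun. Math. Phys. 103 (1986) 323–349, (2.13)–(2.17) p.653, (2.20) p.654, Theorem 3.3 (3.7) p.658 (derivative clause),
Prop. 3.7 (3.63) p.663 (bib key `King1986`); T. Bałaban, Commun. Math. Phys. 89 (1983) 571–597, Theorem (1.10) p.573 clause 2 (bib key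
`Balaban1983RegularityDecay`).
-/

noncomputable section

namespace Summit.QuantumFields.YangMills.BalabanUVNodes.N15.KingModel

open Real Finset Matrix
open Literature.MathematicalPhysics.QuantumFieldTheory.Balaban1983to89 (Params)
open Literature.MathematicalPhysics.QuantumFieldTheory.Balaban1983to89.B4Sect5Proof (latticeConst latticeConst_nonneg)
open Literature.MathematicalPhysics.QuantumFieldTheory.Balaban1983to89.B5Prop11Plancherel (Tor fine unitVec)
open Literature.MathematicalPhysics.QuantumFieldTheory.King1986 (aK aK_pos)
open Literature.MathematicalPhysics.QuantumFieldTheory.King1986.Torus (constrainedProp flatten blockOf tdistT site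
  blockOf_flatten tdistT_nonneg tdistT_sumBound constrainedProp_deriv_decay_blocks_unif)
open Summit.QuantumFields.YangMills.BalabanUVNodes.N15KingModelRung.Curved (KSliceIdx ksM ksU ksDSlice mul_tdistT_blockOf_le
  fullPropD_peel_abs_le ksDSlice_decay_unif)

variable {d : ℕ}

section MassDW

variable (L : ℕ) [NeZero L]

/-- **THE WEIGHTED ROW-UNIFORM RIEMANN MASS OF THE GRADIENT OF KING'S FULL `A = 0` FLUCTUATION PROPAGATOR IS BOUNDED UNIFORMLY IN THE NUMBER OF
LEVELS**: for odd `L ≥ 3`, `a > 0` and a mass cap `m₀² ≥ 0` there are `δ₁, C > 0` such that for EVERY weight rate `0 ≤ δ′ ≤ δ₁`, every `K ≥ 1` (any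
spelling `N = L^K`), every cube `M_μ = 2L^e`, every `0 < m² ≤ m₀²`, every direction `μ` and every fine `x`:
`N^{−(d+1)}·Σ_y |N·(G^η_K(x + e_μ, y) − G^η_K(x, y))|·e^{δ′·|B(x) − B(y)|_M} ≤ C`.  Induction on `K`, weight rate quantified inside (one peel divides it by
`L`): `M_{δ′}(K+1) ≤ L^{−1}e^{δ₁}·(M_{δ′∕L}(K) + C_S·K(κ∕2)) ≤ (2∕3)(C + C_SK(κ∕2)) ≤ C`. [cite: King1986, (2.13)–(2.17) p.653, (2.20) p.654, Theorem 3.3 (3.7) p.658, Prop. 3.7 (3.63) p.663; Balaban1983RegularityDecay, Theorem (1.10) p.573] -/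
theorem fullPropD_riemannMassW_unif (hLodd : Odd L) (hL : 2 ≤ L) {a : ℝ} (ha : 0 < a) {m0sq : ℝ} (hm0 : 0 ≤ m0sq) :
    ∃ δ₁ C : ℝ, 0 < δ₁ ∧ 0 < C ∧ ∀ (K : ℕ), 1 ≤ K → ∀ (δ' : ℝ), 0 ≤ δ' → δ' ≤ δ₁ → ∀ (N : ℕ) [NeZero N], N = L ^ K →
      ∀ (e : ℕ) (M : Fin (d + 1) → ℕ) [∀ μ, NeZero (M μ)], (∀ μ, M μ = 2 * L ^ e) →
      ∀ (msq : ℝ), 0 < msq → msq ≤ m0sq →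
      ∀ (μ : Fin (d + 1)) (x : Tor (fine N M)),
        (((N : ℕ) : ℝ) ^ (d + 1))⁻¹ * ∑ y, |(N : ℝ) * (constrainedProp N M (aK a L K) (((N : ℕ) : ℝ) ^ 2) msq (x + unitVec (fine N M) μ) y
            - constrainedProp N M (aK a L K) (((N : ℕ) : ℝ) ^ 2) msq x y)|
            * Real.exp (δ' * tdistT M (blockOf N M x) (blockOf N M y)) ≤ C := by
  have hL1 : 1 < L := by omega
  have hL3 : 3 ≤ L := three_le_of_odd hLodd hL
  have hL0 : (0 : ℝ) < L := by exact_mod_cast (show 0 < L by omega)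
  have hL1r : (1 : ℝ) ≤ L := by exact_mod_cast hL1.le
  have hL3r : (3 : ℝ) ≤ L := by exact_mod_cast hL3
  obtain ⟨δb, cb, hδb, hcb, Hb⟩ := constrainedProp_deriv_decay_blocks_unif (d + 1) L (by omega) ⟨hLodd, hL1⟩ ha hm0
  obtain ⟨Cs, κ, hCs, hκ, Hs⟩ := ksDSlice_decay_unif (d := d) L hLodd hL ha hm0
  have hKb := latticeConst_nonneg (d + 1) (half_pos hδb).le
  have hKκ := latticeConst_nonneg (d + 1) (half_pos hκ).le
  -- the weight window `δ₁ = min(1∕2, δ_b∕2, κ∕2)` and the constant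
  set δ₁ : ℝ := min (min (1 / 2) (δb / 2)) (κ / 2) with hδ₁def
  have hδ₁ : 0 < δ₁ := lt_min (lt_min (by norm_num) (half_pos hδb)) (half_pos hκ)
  have hδ₁1 : δ₁ ≤ 1 / 2 := (min_le_left _ _).trans (min_le_left _ _)
  have hδ₁b : δ₁ ≤ δb / 2 := (min_le_left _ _).trans (min_le_right _ _)
  have hδ₁κ : δ₁ ≤ κ / 2 := min_le_right _ _
  have hEhalf : Real.exp (1 / 2 : ℝ) ≤ 2 := by
    have hsq : Real.exp (1 / 2 : ℝ) * Real.exp (1 / 2 : ℝ) = Real.exp 1 := by rw [← Real.exp_add]; norm_num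
    have := Real.exp_one_lt_d9
    nlinarith [Real.exp_pos (1 / 2 : ℝ)]
  have hE2 : Real.exp δ₁ ≤ 2 := (Real.exp_le_exp.mpr hδ₁1).trans hEhalf
  set B₀ : ℝ := (L : ℝ) ^ (d + 1) * cb * latticeConst (d + 1) (δb / 2) with hB₀def
  have hB₀ : 0 ≤ B₀ := by positivity
  set C : ℝ := B₀ + 2 * (Cs * latticeConst (d + 1) (κ / 2)) + 1 with hCdef
  have hC : 0 < C := by positivity
  refine ⟨δ₁, C, hδ₁, hC, ?_⟩
  intro K hK
  induction K, hK using Nat.le_induction with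
  | base =>
    intro δ' hδ0 hδ1 N _ hN e M _ hM msq hmsq hcap μ x
    subst hN
    set P : Params := ⟨d + 1, L, e, 1, by omega, ⟨hLodd, hL1⟩⟩ with hPdef
    have hMK : ∀ μ, M μ = P.sitesPerDir P.K := fun μ => by
      rw [hM μ]
      simp [hPdef, Params.sitesPerDir]
    have hpt : ∀ y, |((L ^ 1 : ℕ) : ℝ) * (constrainedProp (L ^ 1) M (aK a L 1) (((L ^ 1 : ℕ) : ℝ) ^ 2) msq (x + unitVec (fine (L ^ 1) M) μ) y
            - constrainedProp (L ^ 1) M (aK a L 1) (((L ^ 1 : ℕ) : ℝ) ^ 2) msq x y)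
          * Real.exp (δ' * tdistT M (blockOf (L ^ 1) M x) (blockOf (L ^ 1) M y))|
        ≤ (L : ℝ) ^ (d + 1) * cb * Real.exp (-(δb / 2 * tdistT M (blockOf (L ^ 1) M x) (blockOf (L ^ 1) M y))) := by
      intro y
      have h := Hb P rfl rfl le_rfl msq hmsq.le hcap M hMK (L ^ 1) rfl x y μ
      have hcast : (((L ^ 1 : ℕ) : ℝ)) ^ P.d * cb = (L : ℝ) ^ (d + 1) * cb := by simp [hPdef]
      rw [hcast] at h
      exact abs_mul_exp_le_of_decay (by positivity) (hδ1.trans hδ₁b) (tdistT_nonneg _ _ _) h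
    calc (((L ^ 1 : ℕ) : ℝ) ^ (d + 1))⁻¹ * ∑ y, |((L ^ 1 : ℕ) : ℝ) *
            (constrainedProp (L ^ 1) M (aK a L 1) (((L ^ 1 : ℕ) : ℝ) ^ 2) msq (x + unitVec (fine (L ^ 1) M) μ) y
              - constrainedProp (L ^ 1) M (aK a L 1) (((L ^ 1 : ℕ) : ℝ) ^ 2) msq x y)|
            * Real.exp (δ' * tdistT M (blockOf (L ^ 1) M x) (blockOf (L ^ 1) M y))
        = (((L ^ 1 : ℕ) : ℝ) ^ (d + 1))⁻¹ * ∑ y, |((L ^ 1 : ℕ) : ℝ) *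
            (constrainedProp (L ^ 1) M (aK a L 1) (((L ^ 1 : ℕ) : ℝ) ^ 2) msq (x + unitVec (fine (L ^ 1) M) μ) y
              - constrainedProp (L ^ 1) M (aK a L 1) (((L ^ 1 : ℕ) : ℝ) ^ 2) msq x y)
            * Real.exp (δ' * tdistT M (blockOf (L ^ 1) M x) (blockOf (L ^ 1) M y))| := by
          refine congrArg _ (sum_congr rfl fun y _ => ?_)
          rw [abs_mul (_ * _), abs_of_pos (Real.exp_pos _)]
      _ ≤ (L : ℝ) ^ (d + 1) * cb * latticeConst (d + 1) (δb / 2) :=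
          riemannSum_le_of_decay (L ^ 1) M (half_pos hδb) (by positivity) (blockOf (L ^ 1) M x) hpt
      _ ≤ C := by rw [hCdef]; linarith [mul_nonneg hCs.le hKκ]
  | succ K hK IH =>
    intro δ' hδ0 hδ1 N _ hN e M _ hM msq hmsq hcap μ x'
    subst hN
    obtain rfl : M = fun _ => 2 * L ^ e := funext hM
    set i : KSliceIdx d := ⟨e, K, hK, 1, le_rfl, 0, Nat.zero_le e, 1, le_rfl⟩ with hidef
    obtain ⟨x, rfl⟩ := (flatten (L ^ K) L (ksM L i)).surjective x'
    have hL2pos : (0 : ℝ) < (L : ℝ) ^ 2 := by positivity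
    have hm2 : 0 < msq / (L : ℝ) ^ 2 := div_pos hmsq hL2pos
    have hm2cap : msq / (L : ℝ) ^ 2 ≤ m0sq := by
      have h1 : (1 : ℝ) ≤ (L : ℝ) ^ 2 := one_le_pow₀ hL1r
      exact (div_le_self hmsq.le h1).trans hcap
    have hM' : ∀ μ, ksU L i μ = 2 * L ^ (e + 1) := fun μ => by
      show L * (2 * L ^ e) = 2 * L ^ (e + 1)
      ring
    -- the weight rate one level down
    have hδL0 : 0 ≤ δ' / L := div_nonneg hδ0 hL0.le
    have hδL1 : δ' / L ≤ δ₁ := (div_le_self hδ0 hL1r).trans hδ1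
    have hδLκ : δ' / L ≤ κ / 2 := hδL1.trans hδ₁κ
    -- the weight under the peel
    have hwt : ∀ y : Tor (fine (L ^ K) (ksU L i)),
        Real.exp (δ' * tdistT (fun _ : Fin (d + 1) => 2 * L ^ e)
          (blockOf (L ^ (K + 1)) (fun _ : Fin (d + 1) => 2 * L ^ e) (flatten (L ^ K) L (ksM L i) x))
          (blockOf (L ^ (K + 1)) (fun _ : Fin (d + 1) => 2 * L ^ e) (flatten (L ^ K) L (ksM L i) y)))
        ≤ Real.exp δ₁ * Real.exp (δ' / L * tdistT (ksU L i) (blockOf (L ^ K) (ksU L i) x) (blockOf (L ^ K) (ksU L i) y)) := by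
      intro y
      rw [← Real.exp_add]
      apply Real.exp_le_exp.mpr
      have hBx : blockOf (L ^ (K + 1)) (fun _ : Fin (d + 1) => 2 * L ^ e) (flatten (L ^ K) L (ksM L i) x)
          = blockOf L (ksM L i) (blockOf (L ^ K) (ksU L i) x) := blockOf_flatten (L ^ K) L (ksM L i) x
      have hBy : blockOf (L ^ (K + 1)) (fun _ : Fin (d + 1) => 2 * L ^ e) (flatten (L ^ K) L (ksM L i) y)
          = blockOf L (ksM L i) (blockOf (L ^ K) (ksU L i) y) := blockOf_flatten (L ^ K) L (ksM L i) y
      have hgrow : (L : ℝ) * tdistT (fun _ : Fin (d + 1) => 2 * L ^ e)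
          (blockOf (L ^ (K + 1)) (fun _ : Fin (d + 1) => 2 * L ^ e) (flatten (L ^ K) L (ksM L i) x))
          (blockOf (L ^ (K + 1)) (fun _ : Fin (d + 1) => 2 * L ^ e) (flatten (L ^ K) L (ksM L i) y))
          ≤ tdistT (ksU L i) (blockOf (L ^ K) (ksU L i) x) (blockOf (L ^ K) (ksU L i) y) + ((L : ℝ) - 1) := by
        rw [hBx, hBy]
        exact mul_tdistT_blockOf_le L (ksM L i) (blockOf (L ^ K) (ksU L i) x) (blockOf (L ^ K) (ksU L i) y)
      have h := weight_peel_le hL1r hδ0 hδ1 hgrow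
      linarith
    -- the induction hypothesis at the weight rate `δ′∕L` on the finer cube
    have hIH : (((L ^ K : ℕ) : ℝ) ^ (d + 1))⁻¹ *
          ∑ y, |((L ^ K : ℕ) : ℝ) * (constrainedProp (L ^ K) (ksU L i) (aK a L K) (((L ^ K : ℕ) : ℝ) ^ 2) (msq / (L : ℝ) ^ 2)
              (x + unitVec (fine (L ^ K) (ksU L i)) μ) y
            - constrainedProp (L ^ K) (ksU L i) (aK a L K) (((L ^ K : ℕ) : ℝ) ^ 2) (msq / (L : ℝ) ^ 2) x y)|
            * Real.exp (δ' / L * tdistT (ksU L i) (blockOf (L ^ K) (ksU L i) x) (blockOf (L ^ K) (ksU L i) y)) ≤ C :=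
      IH (δ' / L) hδL0 hδL1 (L ^ K) rfl (e + 1) (ksU L i) hM' (msq / (L : ℝ) ^ 2) hm2 hm2cap μ x
    -- the weighted differentiated-slice mass
    have hS : (((L ^ K : ℕ) : ℝ) ^ (d + 1))⁻¹ *
          ∑ y, |ksDSlice L a (msq / (L : ℝ) ^ 2) i μ x y
            * Real.exp (δ' / L * tdistT (ksU L i) (blockOf (L ^ K) (ksU L i) x) (blockOf (L ^ K) (ksU L i) y))|
        ≤ Cs * latticeConst (d + 1) (κ / 2) :=
      riemannSum_le_of_decay (L ^ K) (ksU L i) (half_pos hκ) hCs.le (blockOf (L ^ K) (ksU L i) x) fun y =>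
        abs_mul_exp_le_of_decay hCs.le hδLκ (tdistT_nonneg _ _ _) ((Hs (msq / (L : ℝ) ^ 2) hm2 hm2cap i μ).1 x y)
    have hNK : (0 : ℝ) < ((L ^ K : ℕ) : ℝ) ^ (d + 1) := by positivity
    have hcast : (((L ^ (K + 1) : ℕ) : ℝ)) ^ (d + 1) = (L : ℝ) ^ (d + 1) * ((L ^ K : ℕ) : ℝ) ^ (d + 1) := by
      push_cast; ring
    -- abbreviate the weighted summands
    set W : Tor (fine (L ^ K) (ksU L i)) → ℝ := fun y =>
      Real.exp (δ' / L * tdistT (ksU L i) (blockOf (L ^ K) (ksU L i) x) (blockOf (L ^ K) (ksU L i) y)) with hWdef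
    have hW0 : ∀ y, 0 ≤ W y := fun y => (Real.exp_pos _).le
    set D' : Tor (fine (L ^ K * L) (ksM L i)) → ℝ := fun y' =>
      ((L ^ K * L : ℕ) : ℝ) * (constrainedProp (L ^ K * L) (ksM L i) (aK a L (K + 1)) (((L ^ K * L : ℕ) : ℝ) ^ 2) msq
          (flatten (L ^ K) L (ksM L i) x + unitVec (fine (L ^ K * L) (ksM L i)) μ) y'
        - constrainedProp (L ^ K * L) (ksM L i) (aK a L (K + 1)) (((L ^ K * L : ℕ) : ℝ) ^ 2) msq (flatten (L ^ K) L (ksM L i) x) y')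
      with hD'def
    set D : Tor (fine (L ^ K) (ksU L i)) → ℝ := fun y =>
      ((L ^ K : ℕ) : ℝ) * (constrainedProp (L ^ K) (ksU L i) (aK a L K) (((L ^ K : ℕ) : ℝ) ^ 2) (msq / (L : ℝ) ^ 2)
          (x + unitVec (fine (L ^ K) (ksU L i)) μ) y
        - constrainedProp (L ^ K) (ksU L i) (aK a L K) (((L ^ K : ℕ) : ℝ) ^ 2) (msq / (L : ℝ) ^ 2) x y) with hDdef
    have hsum : ∑ y', |D' y'|
          * Real.exp (δ' * tdistT (fun _ : Fin (d + 1) => 2 * L ^ e)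
            (blockOf (L ^ (K + 1)) (fun _ : Fin (d + 1) => 2 * L ^ e) (flatten (L ^ K) L (ksM L i) x))
            (blockOf (L ^ (K + 1)) (fun _ : Fin (d + 1) => 2 * L ^ e) y'))
        = ∑ y, |D' (flatten (L ^ K) L (ksM L i) y)|
          * Real.exp (δ' * tdistT (fun _ : Fin (d + 1) => 2 * L ^ e)
            (blockOf (L ^ (K + 1)) (fun _ : Fin (d + 1) => 2 * L ^ e) (flatten (L ^ K) L (ksM L i) x))
            (blockOf (L ^ (K + 1)) (fun _ : Fin (d + 1) => 2 * L ^ e) (flatten (L ^ K) L (ksM L i) y))) :=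
      (Fintype.sum_equiv (flatten (L ^ K) L (ksM L i)) _ _ fun y => rfl).symm
    have hterm : ∀ y, |D' (flatten (L ^ K) L (ksM L i) y)|
          * Real.exp (δ' * tdistT (fun _ : Fin (d + 1) => 2 * L ^ e)
            (blockOf (L ^ (K + 1)) (fun _ : Fin (d + 1) => 2 * L ^ e) (flatten (L ^ K) L (ksM L i) x))
            (blockOf (L ^ (K + 1)) (fun _ : Fin (d + 1) => 2 * L ^ e) (flatten (L ^ K) L (ksM L i) y)))
        ≤ (L : ℝ) ^ (d + 1) / (L : ℝ) ^ 2 * L * Real.exp δ₁ * (|D y| * W y + |ksDSlice L a (msq / (L : ℝ) ^ 2) i μ x y * W y|) := by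
      intro y
      have hp : |D' (flatten (L ^ K) L (ksM L i) y)| ≤ (L : ℝ) ^ (d + 1) / (L : ℝ) ^ 2 * L *
          (|D y| + |ksDSlice L a (msq / (L : ℝ) ^ 2) i μ x y|) := fullPropD_peel_abs_le L hL ha hmsq i μ x y
      have hSW : |ksDSlice L a (msq / (L : ℝ) ^ 2) i μ x y * W y| = |ksDSlice L a (msq / (L : ℝ) ^ 2) i μ x y| * W y := by
        rw [abs_mul, abs_of_nonneg (hW0 y)]
      rw [hSW]
      calc _ ≤ (L : ℝ) ^ (d + 1) / (L : ℝ) ^ 2 * L * (|D y| + |ksDSlice L a (msq / (L : ℝ) ^ 2) i μ x y|) * (Real.exp δ₁ * W y) :=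
            mul_le_mul hp (hwt y) (Real.exp_pos _).le (by positivity)
        _ = _ := by ring
    show (((L ^ (K + 1) : ℕ) : ℝ) ^ (d + 1))⁻¹ * ∑ y', |D' y'|
          * Real.exp (δ' * tdistT (fun _ : Fin (d + 1) => 2 * L ^ e)
            (blockOf (L ^ (K + 1)) (fun _ : Fin (d + 1) => 2 * L ^ e) (flatten (L ^ K) L (ksM L i) x))
            (blockOf (L ^ (K + 1)) (fun _ : Fin (d + 1) => 2 * L ^ e) y')) ≤ C
    calc (((L ^ (K + 1) : ℕ) : ℝ) ^ (d + 1))⁻¹ * ∑ y', |D' y'|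
            * Real.exp (δ' * tdistT (fun _ : Fin (d + 1) => 2 * L ^ e)
              (blockOf (L ^ (K + 1)) (fun _ : Fin (d + 1) => 2 * L ^ e) (flatten (L ^ K) L (ksM L i) x))
              (blockOf (L ^ (K + 1)) (fun _ : Fin (d + 1) => 2 * L ^ e) y'))
        ≤ (((L ^ (K + 1) : ℕ) : ℝ) ^ (d + 1))⁻¹ * ∑ y, (L : ℝ) ^ (d + 1) / (L : ℝ) ^ 2 * L * Real.exp δ₁ *
            (|D y| * W y + |ksDSlice L a (msq / (L : ℝ) ^ 2) i μ x y * W y|) := by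
          rw [hsum]
          exact mul_le_mul_of_nonneg_left (sum_le_sum fun y _ => hterm y) (by positivity)
      _ = (L : ℝ)⁻¹ * Real.exp δ₁ *
            ((((L ^ K : ℕ) : ℝ) ^ (d + 1))⁻¹ * ∑ y, |D y| * W y
              + (((L ^ K : ℕ) : ℝ) ^ (d + 1))⁻¹ * ∑ y, |ksDSlice L a (msq / (L : ℝ) ^ 2) i μ x y * W y|) := by
          rw [hcast, ← mul_sum, sum_add_distrib]
          field_simp
          ring
      _ ≤ (L : ℝ)⁻¹ * Real.exp δ₁ * (C + Cs * latticeConst (d + 1) (κ / 2)) :=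
          mul_le_mul_of_nonneg_left (add_le_add hIH hS) (by positivity)
      _ ≤ (2 / 3) * (C + Cs * latticeConst (d + 1) (κ / 2)) := by
          refine mul_le_mul_of_nonneg_right ?_ (by positivity)
          have h3 : (L : ℝ)⁻¹ ≤ 1 / 3 := by rw [one_div]; exact inv_anti₀ (by norm_num) hL3r
          calc (L : ℝ)⁻¹ * Real.exp δ₁ ≤ (1 / 3) * 2 := mul_le_mul h3 hE2 (Real.exp_pos _).le (by norm_num)
            _ = 2 / 3 := by norm_num
      _ ≤ C := by rw [hCdef]; nlinarith [mul_nonneg hCs.le hKκ, hB₀]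

end MassDW

end Summit.QuantumFields.YangMills.BalabanUVNodes.N15.KingModel
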